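import Mathlib
import HarnessLib
import Summits.HubbardSuperconductivity.HubbardSuperconductivity.Theorems.KLProgrammeKLRegimeEnginePairTransferK5Step

/-!
# Route `KLProgramme` — ENGINE child gen 8 (stmt-HubbardSuperconductivity-20437 `KLRegimeEngineV17F2`), skeleton v2 stub (X).3 / class #5 rev 3 (Export5):
# `PairTransferStep5` from a PRIVATE INVARIANT carried by the producer's own induction — `pairTransferStep5_of_private`
# (cell gate-hubbard-kl, seat hubbard-kl-k3c1-p1 g11, technique «composed-map remainder propagation»; companion of `…EnginePairTransferRelResStep`)

WHY.  `PairTransferStep5 P R Q₀ r u` hands the producer, at scale `n`, the history `∀ j < n, PairTransferRelFamilyK5 … j` in the FORWARD form of the frozen clause.  A producer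
that prefers a STRONGER private invariant `Priv … n` (e.g. the relative-residue family «`‖Ẽ_n(j,j′)‖ ≤ Rb n j′` on the ball», `…EnginePairTransferRelResStep`, which avoids the
fwd ↔ Ẽ conversions of the inherited bar — located item #19 «(c)-DRESSING-AVG») may ignore that history and re-derive `Priv … j` for every `j ≤ n` from the binders at `n`
(they are downward monotone: `histP_klPredsV17F2_of_le`, `frameOK_klFlowFrameU_of_histP`, `isKLRegime_of_le_nScales_succ`; the bare frame is admissible by
`klFrameOK_zeroC` from `R.WF` — passed as the hypothesis `h0`, as in `…ExportUnroll`, to stay outside the route cone), then EXPORT the frozen clause at `n`: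
* **`pairTransferStep5_of_private`** — from `R.WF2`, the bare frame's admissibility `h0`, a private predicate `Priv G Q cc μ U β L M n`, (BASE) `Priv … 0` under the v2 binders at `0`, (STEP) `Priv … n → Priv … (n+1)`
  under the v2 binders at `n+1`, and (EXPORT) `Priv … n → PairTransferRelFamilyK5 … n` under the v2 binders at `n`: `PairTransferStep5 P R Q₀ r u`.
  (With `Priv := PairTransferRelFamilyK5` and EXPORT `= id` this is `pairTransferStep5_of_base_and_succ` without reading the handed history.)
Plumbing only; nothing about the model is asserted; nothing asserts any stub, K3 or superconductivity.  0 kit.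
-/

noncomputable section

namespace Summit.HubbardSuperconductivity.HubbardSuperconductivity.Theorems.KLRegimeSplit

set_option linter.dupNamespace false -- summit = problem name (single-conjunct summit), D-0017

open Finset Matrix Set Literature.MathematicalPhysics.QuantumLattice Literature.Probability.LatticeModels
open Literature.MathematicalPhysics.QuantumLattice.FermiRG
open Summit.HubbardSuperconductivity.HubbardSuperconductivity.Theorems.KLProgrammeLegKernels
open Summit.HubbardSuperconductivity.HubbardSuperconductivity.Theorems.DispersionFlow
open Summit.HubbardSuperconductivity.HubbardSuperconductivity.Theorems.EngineV8

section Private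

set_option maxHeartbeats 800000 in -- long binder lists; plumbing
/-- **`pairTransferStep5_of_private`** — `PairTransferStep5` from a private invariant with BASE / STEP / EXPORT clauses under the v2 binders (see the module docstring). -/
theorem pairTransferStep5_of_private {P : SplitConsts} {R : RenConsts} {Q₀ : EngConsts} {r : ℝ} {u : EngConsts → ℝ → ℝ} (hR : R.WF2)
    (h0 : ∀ (U μ β : ℝ), μ ∈ klWindowC → FrameOK R U (nScales β) μ 0) (Priv : GeoConsts → EngConsts → ℝ → ℝ → ℝ → ℝ → ℕ → ℕ → ℕ → Prop)
    (hbase : ∀ G : GeoConsts, G.WF → ∀ Q : EngConsts, Q₀.IsRaiseOf Q →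
      ∀ cc : ℝ, 0 < cc → cc ≤ klEngC₃6 P R →
        ∀ μ ∈ klWindowC, ∀ U : ℝ, 0 < U → U ≤ klEngU₀10 P R cc → U ≤ u Q cc →
          ∀ β : ℝ, klBetaMin ≤ β → β ≤ Real.exp (cc / U ^ 2) →
            ∀ (L M : ℕ) [NeZero L] [NeZero M], klEngL₄ P R β U ≤ L → klEngM₃ β U L ≤ M →
              0 ≤ nScales β + 1 → IsKLRegime U cc (-((0 : ℕ) : ℤ)) →
                HistP klPredsV17F2 L M G P Q R β U μ 0 (0) →
                  FrameOK R U (nScales β) μ (klFlowFrameU L M β U μ (0)) →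
                    (∀ j ≤ 0, LevelsUExportMixedAt L M (klCU2 P R Q₀) P β U μ j) →
                      Priv G Q cc μ U β L M 0)
    (hsucc : ∀ G : GeoConsts, G.WF → ∀ Q : EngConsts, Q₀.IsRaiseOf Q →
      ∀ cc : ℝ, 0 < cc → cc ≤ klEngC₃6 P R →
        ∀ μ ∈ klWindowC, ∀ U : ℝ, 0 < U → U ≤ klEngU₀10 P R cc → U ≤ u Q cc →
          ∀ β : ℝ, klBetaMin ≤ β → β ≤ Real.exp (cc / U ^ 2) →
            ∀ (L M : ℕ) [NeZero L] [NeZero M], klEngL₄ P R β U ≤ L → klEngM₃ β U L ≤ M →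
              ∀ n : ℕ, n + 1 ≤ nScales β + 1 → IsKLRegime U cc (-((n + 1 : ℕ) : ℤ)) →
                HistP klPredsV17F2 L M G P Q R β U μ 0 (n + 1) →
                  FrameOK R U (nScales β) μ (klFlowFrameU L M β U μ (n + 1)) →
                    (∀ j ≤ n + 1, LevelsUExportMixedAt L M (klCU2 P R Q₀) P β U μ j) →
                      Priv G Q cc μ U β L M n → Priv G Q cc μ U β L M (n + 1))
    (hexport : ∀ G : GeoConsts, G.WF → ∀ Q : EngConsts, Q₀.IsRaiseOf Q →
      ∀ cc : ℝ, 0 < cc → cc ≤ klEngC₃6 P R →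
        ∀ μ ∈ klWindowC, ∀ U : ℝ, 0 < U → U ≤ klEngU₀10 P R cc → U ≤ u Q cc →
          ∀ β : ℝ, klBetaMin ≤ β → β ≤ Real.exp (cc / U ^ 2) →
            ∀ (L M : ℕ) [NeZero L] [NeZero M], klEngL₄ P R β U ≤ L → klEngM₃ β U L ≤ M →
              ∀ n : ℕ, n ≤ nScales β + 1 → IsKLRegime U cc (-((n : ℕ) : ℤ)) →
                HistP klPredsV17F2 L M G P Q R β U μ 0 (n) →
                  FrameOK R U (nScales β) μ (klFlowFrameU L M β U μ (n)) →
                    (∀ j ≤ n, LevelsUExportMixedAt L M (klCU2 P R Q₀) P β U μ j) →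
                      Priv G Q cc μ U β L M n → PairTransferRelFamilyK5 L M G P r β U μ n) :
    PairTransferStep5 P R Q₀ r u := by
  intro G hG Q hQ cc hcc0 hcc μ hμ U hU hU10 hUu β hβ hβc L M _ _ hL hM n hn hreg hhist hK hlev _hfam
  have h0' : FrameOK R U (nScales β) μ 0 := h0 U μ β hμ
  -- every `j ≤ n` carries the binders at `j`
  have hregj : ∀ j ≤ n, IsKLRegime U cc (-((j : ℕ) : ℤ)) := fun j hj => isKLRegime_of_le_nScales_succ hcc0.le hβ hβc (hj.trans hn)
  have hhistj : ∀ j ≤ n, HistP klPredsV17F2 L M G P Q R β U μ 0 j := fun j hj => histP_klPredsV17F2_of_le hhist hj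
  have hKj : ∀ j ≤ n, FrameOK R U (nScales β) μ (klFlowFrameU L M β U μ j) := fun j hj =>
    frameOK_klFlowFrameU_of_histP hR h0' (hj.trans hn) (hhistj j hj)
  -- the private invariant at every `j ≤ n`, by induction
  have hpriv : ∀ j ≤ n, Priv G Q cc μ U β L M j := by
    intro j
    induction j with
    | zero =>
        intro hj
        exact hbase G hG Q hQ cc hcc0 hcc μ hμ U hU hU10 hUu β hβ hβc L M hL hM (hj.trans hn) (hregj 0 hj) (hhistj 0 hj) (hKj 0 hj)
          (fun i hi => hlev i (hi.trans hj))
    | succ j ih =>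
        intro hj
        exact hsucc G hG Q hQ cc hcc0 hcc μ hμ U hU hU10 hUu β hβ hβc L M hL hM j (hj.trans hn) (hregj _ hj) (hhistj _ hj) (hKj _ hj)
          (fun i hi => hlev i (hi.trans hj)) (ih ((Nat.le_succ j).trans hj))
  exact hexport G hG Q hQ cc hcc0 hcc μ hμ U hU hU10 hUu β hβ hβc L M hL hM n hn hreg hhist hK hlev (hpriv n le_rfl)

end Private

end Summit.HubbardSuperconductivity.HubbardSuperconductivity.Theorems.KLRegimeSplit

end
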